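import Mathlib
import Literature.Probability.Percolation.PercolationProofs
import Literature.Probability.Percolation.ConditionalPositiveAssociation
import Summits.CriticalPhenomena.PercolationContinuityZ3.Theorems.PercNearOneGluingAdditiveGluingSigmaGeometry
import Summits.CriticalPhenomena.PercolationContinuityZ3.Theorems.PercNearOneGluingAdditiveGluingSigmaLaw
import Summits.CriticalPhenomena.PercolationContinuityZ3.Theorems.PercNearOneGluingAdditiveGluingGluingLemma5
import Summits.CriticalPhenomena.PercolationContinuityZ3.Theorems.PercNearOneGluingAdditiveGluingSigmaRecursion
import Summits.CriticalPhenomena.PercolationContinuityZ3.Theorems.PercNearOneGluingAdditiveGluingKnLemma3ii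
import Summits.CriticalPhenomena.PercolationContinuityZ3.Theorems.PercNearOneGluingAdditiveGluingGluePushforward
import Summits.CriticalPhenomena.PercolationContinuityZ3.Theorems.PercNearOneGluingAdditiveGluingGlueReach
import Summits.CriticalPhenomena.PercolationContinuityZ3.Theorems.PercNearOneGluingAdditiveGluingDefectTwoRelays
import HarnessLib

/-!
# Crux `PercNearOneGluing.AdditiveGluing` (stmt-CriticalPhenomena-4576), line `sigma-recursion-lemma5-any-relay`
# — PARTIAL RESULTS of the σ-recursion (sorry-free): additive gluing for at most two relays, and
# for an observer isolated in `G ∖ A` (Kozma–Nitzan Thm 4, additive form)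

Lead prover-line-stmt-CriticalPhenomena-4576-0, 2026-08-16.  Lands with `--supports stmt-CriticalPhenomena-4576`.

The line's skeleton (`Cruxes/AdditiveGluing/Lines/sigma-recursion-lemma5-any-relay.lean`) proves the crux
`AdditiveGluing` from registered stubs, all of which have landed except the core under `Theorems/PercNearOneGluingAdditiveGluing*.lean`;
the last, `stub_gluingDefectCore` (at least THREE relays with genuine relay drift under block contraction), is
open.  The recursion never changes the relay set `A`, and the core is only invoked when `A` has three distinct
elements, so the very same recursion — written out here against the landed helper theorems, with `A.card ≤ 2`
carried through the strong induction — proves UNCONDITIONALLY: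

* `additiveGluing_of_card_le_two` : `AdditiveGluing` restricted to `A.card ≤ 2`
  (for every finite weighted graph, `P(o ↔ A) − t ≤ P(o ↔ b)` whenever `0 ≤ t` and `P(a ↔ b) ≥ 1 − t` on `A`).
  In print this case follows from Kozma–Nitzan arXiv:2401.12397 Thm 1 (`|A| = 2` of their inequality (3))
  and `(1−x)(1−y) ≥ 1−x−y`; the proof here is the line's own route (σ-recursion + KN Lemma 5 for an arbitrary
  relay + KN Lemma 3(ii) for the two-relay gluing defect).
* `additiveGluing_of_isolated` : `AdditiveGluing` for any `A` when every positive-weight pair at `o` goes into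
  `A` ("`o` isolated in `G ∖ A`", KN Thm 4's class): then every non-empty σ-layer meets `A`, the defect branch is
  vacuous, and no induction is needed.

Notation (all EXPANDED in statements, no new definitions): `glue w O = fun e => if (∀ x ∈ e, x ∈ O) ∧ ¬ e.IsDiag
then 1 else w e` (contract the block `O`), `kill w O = fun e => if (∃ x ∈ e, x ∈ O) then 0 else w e` (delete it),
`{O ↔ X} = ⋃ o ∈ O, ⋃ x ∈ X, openConn o x`.
-/

namespace Summit.CriticalPhenomena.PercolationContinuityZ3.Theorems

open MeasureTheory Set
open Literature.Probability.LatticeModels (prodBernoulli)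
open Literature.Probability.Percolation (BondConfig openConn openGraph openEdgeCluster)

noncomputable section
open Classical

/-- **The induction measure strictly decreases** along the recursion: if `S` is a non-empty set of
outside vertices each joined to the block `O` by a positive-weight pair, then the live vertices outside `S`
of the `O`-deleted weights form a strict subset of the live vertices outside `O`. [folklore] -/
theorem agPartial_live_card_lt {n : ℕ} (w : Sym2 (Fin n) → unitInterval) (O S : Finset (Fin n))
    (hS : ∀ x ∈ S, x ∉ O ∧ ∃ o ∈ O, w s(o, x) ≠ 0) (hne : S.Nonempty) :
    (Finset.univ.filter (fun x : Fin n => x ∉ S ∧ ∃ e : Sym2 (Fin n), x ∈ e ∧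
        (fun e : Sym2 (Fin n) => if (∃ x ∈ e, x ∈ O) then (0 : unitInterval) else w e) e ≠ 0)).card <
      (Finset.univ.filter (fun x : Fin n => x ∉ O ∧ ∃ e : Sym2 (Fin n), x ∈ e ∧ w e ≠ 0)).card := by
  apply Finset.card_lt_card
  have hsub : (Finset.univ.filter (fun x : Fin n => x ∉ S ∧ ∃ e : Sym2 (Fin n), x ∈ e ∧
        (fun e : Sym2 (Fin n) => if (∃ x ∈ e, x ∈ O) then (0 : unitInterval) else w e) e ≠ 0)) ⊆
      (Finset.univ.filter (fun x : Fin n => x ∉ O ∧ ∃ e : Sym2 (Fin n), x ∈ e ∧ w e ≠ 0)) := by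
    intro x hx
    simp only [Finset.mem_filter, Finset.mem_univ, true_and] at hx ⊢
    obtain ⟨_, e, hxe, hwe⟩ := hx
    split_ifs at hwe with hex
    · exact absurd rfl hwe
    · push Not at hex
      exact ⟨hex x hxe, e, hxe, hwe⟩
  obtain ⟨x, hxS⟩ := hne
  obtain ⟨hxO, o, hoO, hwo⟩ := hS x hxS
  refine (Finset.ssubset_iff_of_subset hsub).2 ⟨x, ?_, ?_⟩
  · simp only [Finset.mem_filter, Finset.mem_univ, true_and]
    exact ⟨hxO, s(o, x), Sym2.mem_mk_right o x, hwo⟩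
  · simp only [Finset.mem_filter, Finset.mem_univ, true_and, not_and]
    intro h
    exact absurd hxS h

/-- **The gluing defect for at most two relays** (the line's `stub_gluingDefect` with the core branch
excluded by `A.card ≤ 2`): block `S`, `a` the pre-contraction minimiser, the induction hypothesis for every
minimiser of the block-deleted reliability; conclusion: the designated inequality in `G/S` with `a`.
No drift ⇒ the induction hypothesis; drift ⇒ `A = {a, a₁}` and `stub_defectTwoRelays` (KN Lemma 3(ii)). -/
theorem agPartial_defect_two (n : ℕ) (w : Sym2 (Fin n) → unitInterval) (S A : Finset (Fin n)) (b a : Fin n)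
    (hA2 : A.card ≤ 2) (hSA : Disjoint S A) (hb : b ∉ S) (ha : a ∈ A)
    (hmin : ∀ a' ∈ A, (prodBernoulli w).real (openConn a b) ≤ (prodBernoulli w).real (openConn a' b))
    (hIH : ∀ a' ∈ A,
      (∀ a'' ∈ A,
        (prodBernoulli (fun e : Sym2 (Fin n) => if (∃ x ∈ e, x ∈ S) then 0 else w e)).real
            (openConn a' b) ≤
          (prodBernoulli (fun e : Sym2 (Fin n) => if (∃ x ∈ e, x ∈ S) then 0 else w e)).real
            (openConn a'' b)) →
      (prodBernoulli (fun e : Sym2 (Fin n) =>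
          if (∀ x ∈ e, x ∈ S) ∧ ¬ e.IsDiag then 1 else w e)).real (⋃ s ∈ S, ⋃ x ∈ A, openConn s x) -
        (prodBernoulli (fun e : Sym2 (Fin n) =>
          if (∀ x ∈ e, x ∈ S) ∧ ¬ e.IsDiag then 1 else w e)).real (⋃ s ∈ S, openConn s b) ≤
        1 - (prodBernoulli (fun e : Sym2 (Fin n) =>
          if (∀ x ∈ e, x ∈ S) ∧ ¬ e.IsDiag then 1 else w e)).real (openConn a' b)) :
    (prodBernoulli (fun e : Sym2 (Fin n) =>
        if (∀ x ∈ e, x ∈ S) ∧ ¬ e.IsDiag then 1 else w e)).real (⋃ s ∈ S, ⋃ x ∈ A, openConn s x) -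
      (prodBernoulli (fun e : Sym2 (Fin n) =>
        if (∀ x ∈ e, x ∈ S) ∧ ¬ e.IsDiag then 1 else w e)).real (⋃ s ∈ S, openConn s b) ≤
      1 - (prodBernoulli (fun e : Sym2 (Fin n) =>
        if (∀ x ∈ e, x ∈ S) ∧ ¬ e.IsDiag then 1 else w e)).real (openConn a b) := by
  obtain ⟨a₁, ha₁, hmin₁⟩ := Finset.exists_min_image A
    (fun x => (prodBernoulli (fun e : Sym2 (Fin n) => if (∃ x ∈ e, x ∈ S) then 0 else w e)).real
      (openConn x b)) ⟨a, ha⟩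
  have hIH₁ := hIH a₁ ha₁ hmin₁
  by_cases hdrift : (prodBernoulli (fun e : Sym2 (Fin n) =>
      if (∀ x ∈ e, x ∈ S) ∧ ¬ e.IsDiag then 1 else w e)).real (openConn a b) ≤
        (prodBernoulli (fun e : Sym2 (Fin n) =>
          if (∀ x ∈ e, x ∈ S) ∧ ¬ e.IsDiag then 1 else w e)).real (openConn a₁ b)
  · linarith
  push Not at hdrift
  have hne : a ≠ a₁ := fun h => by rw [h] at hdrift; exact lt_irrefl _ hdrift
  -- `A = {a, a₁}`
  have hAeq : A = {a, a₁} := by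
    symm
    apply Finset.eq_of_subset_of_card_le
    · intro x hx
      rcases Finset.mem_insert.1 hx with rfl | hx
      · exact ha
      · rw [Finset.mem_singleton.1 hx]; exact ha₁
    · rw [Finset.card_pair hne]; exact hA2
  have haS : a ∉ S := fun h => Finset.disjoint_left.1 hSA h ha
  have ha₁S : a₁ ∉ S := fun h => Finset.disjoint_left.1 hSA h ha₁
  have htwo := stub_defectTwoRelays n (stub_knLemma3ii n) (stub_gluePushforward n)
    (stub_glueReach n) w S a a₁ b hb haS ha₁S (hmin a₁ ha₁)
  have hsub : (⋃ s ∈ S, ⋃ x ∈ A, (openConn s x : Set (BondConfig (Fin n)))) ⊆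
      ⋃ s ∈ S, (openConn s a ∪ openConn s a₁) := by
    intro ω hω
    simp only [Set.mem_iUnion, exists_prop] at hω
    obtain ⟨s, hs, x, hx, hωx⟩ := hω
    simp only [Set.mem_iUnion, exists_prop, Set.mem_union]
    refine ⟨s, hs, ?_⟩
    rw [hAeq, Finset.mem_insert, Finset.mem_singleton] at hx
    rcases hx with rfl | rfl
    · exact Or.inl hωx
    · exact Or.inr hωx
  have hmono := measureReal_mono (μ := prodBernoulli (fun e : Sym2 (Fin n) =>
    if (∀ x ∈ e, x ∈ S) ∧ ¬ e.IsDiag then 1 else w e)) hsub (measure_ne_top _ _)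
  linarith

/-- **The σ-recursion with at most two relays** (strong induction on the number of live vertices outside
the block): for every block `O` disjoint from `A`, `b ∉ O`, and every minimiser `a` of the block-DELETED
reliability over `A`, the designated inequality `P_{G/O}(O ↔ A) − P_{G/O}(O ↔ b) ≤ P_{G/O}(a ↮ b)` holds.
Layers meeting `A`: KN Lemma 5 (`stub_gluingLemma5`); layers avoiding `A`: the induction hypothesis through
`agPartial_defect_two`; bookkeeping: `stub_sigmaRecursion` with `stub_sigmaGeometry`, `stub_sigmaLaw`. -/
theorem agPartial_designated (n : ℕ) (A : Finset (Fin n)) (hA2 : A.card ≤ 2) :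
    ∀ (m : ℕ) (w : Sym2 (Fin n) → unitInterval) (O : Finset (Fin n)) (b a : Fin n),
      (Finset.univ.filter (fun x : Fin n => x ∉ O ∧ ∃ e : Sym2 (Fin n), x ∈ e ∧ w e ≠ 0)).card = m →
      Disjoint O A → b ∉ O → a ∈ A →
      (∀ a' ∈ A, (prodBernoulli (fun e : Sym2 (Fin n) => if (∃ x ∈ e, x ∈ O) then 0 else w e)).real
          (openConn a b) ≤
        (prodBernoulli (fun e : Sym2 (Fin n) => if (∃ x ∈ e, x ∈ O) then 0 else w e)).real
          (openConn a' b)) →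
      (prodBernoulli (fun e : Sym2 (Fin n) =>
          if (∀ x ∈ e, x ∈ O) ∧ ¬ e.IsDiag then 1 else w e)).real (⋃ o ∈ O, ⋃ x ∈ A, openConn o x) -
        (prodBernoulli (fun e : Sym2 (Fin n) =>
          if (∀ x ∈ e, x ∈ O) ∧ ¬ e.IsDiag then 1 else w e)).real (⋃ o ∈ O, openConn o b) ≤
        1 - (prodBernoulli (fun e : Sym2 (Fin n) =>
          if (∀ x ∈ e, x ∈ O) ∧ ¬ e.IsDiag then 1 else w e)).real (openConn a b) := by
  intro m
  induction m using Nat.strong_induction_on with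
  | _ m IH =>
    intro w O b a hm hOA hb ha hmin
    refine stub_sigmaRecursion n w O A b a hOA hb ha (stub_sigmaGeometry n O) (stub_sigmaLaw n w O)
      ?_ ?_
    · intro S _ hSA hbS
      obtain ⟨v, hv⟩ := hSA
      rw [Finset.mem_inter] at hv
      exact stub_gluingLemma5 n (fun e : Sym2 (Fin n) => if (∃ x ∈ e, x ∈ O) then 0 else w e) S a v b
        hv.1 hbS (hmin v hv.2)
    · intro S hS hSne hSA hbS
      refine agPartial_defect_two n (fun e : Sym2 (Fin n) => if (∃ x ∈ e, x ∈ O) then 0 else w e)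
        S A b a hA2 hSA hbS ha hmin ?_
      intro a' ha'A hmin'
      exact IH _ (hm ▸ agPartial_live_card_lt w O S hS hSne)
        (fun e : Sym2 (Fin n) => if (∃ x ∈ e, x ∈ O) then 0 else w e) S b a' rfl hSA hbS ha'A hmin'

/-- Contracting a one-vertex block changes nothing: `glue w {o} = w`. [folklore] -/
theorem agPartial_glue_singleton {n : ℕ} (w : Sym2 (Fin n) → unitInterval) (o : Fin n) :
    (fun e : Sym2 (Fin n) => if (∀ x ∈ e, x ∈ ({o} : Finset (Fin n))) ∧ ¬ e.IsDiag then 1 else w e) = w := by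
  funext e
  induction e using Sym2.ind with
  | h x y =>
    split_ifs with h
    · exfalso
      obtain ⟨h1, h2⟩ := h
      have hx : x = o := by simpa using h1 x (Sym2.mem_mk_left x y)
      have hy : y = o := by simpa using h1 y (Sym2.mem_mk_right x y)
      exact h2 (by rw [Sym2.mk_isDiag_iff]; rw [hx, hy])
    · rfl

/-- From the designated inequality at the one-vertex block `{o}` to the crux's shape: the common final step
(case splits `o ∈ A`, `b = o`, `A = ∅`, then the relay hypothesis at the designated relay). -/
theorem agPartial_final (n : ℕ) (w : Sym2 (Fin n) → unitInterval) (A : Finset (Fin n)) (o b : Fin n)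
    (t : ℝ) (ht : 0 ≤ t) (hrel : ∀ a ∈ A, 1 - t ≤ (prodBernoulli w).real (openConn a b))
    (hdes : ∀ a ∈ A, o ∉ A → b ≠ o →
      (∀ a' ∈ A, (prodBernoulli (fun e : Sym2 (Fin n) => if (∃ x ∈ e, x ∈ ({o} : Finset (Fin n)))
          then 0 else w e)).real (openConn a b) ≤
        (prodBernoulli (fun e : Sym2 (Fin n) => if (∃ x ∈ e, x ∈ ({o} : Finset (Fin n)))
          then 0 else w e)).real (openConn a' b)) →
      (prodBernoulli (fun e : Sym2 (Fin n) =>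
          if (∀ x ∈ e, x ∈ ({o} : Finset (Fin n))) ∧ ¬ e.IsDiag then 1 else w e)).real
          (⋃ o' ∈ ({o} : Finset (Fin n)), ⋃ x ∈ A, openConn o' x) -
        (prodBernoulli (fun e : Sym2 (Fin n) =>
          if (∀ x ∈ e, x ∈ ({o} : Finset (Fin n))) ∧ ¬ e.IsDiag then 1 else w e)).real
          (⋃ o' ∈ ({o} : Finset (Fin n)), openConn o' b) ≤
        1 - (prodBernoulli (fun e : Sym2 (Fin n) =>
          if (∀ x ∈ e, x ∈ ({o} : Finset (Fin n))) ∧ ¬ e.IsDiag then 1 else w e)).real (openConn a b)) :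
    (prodBernoulli w).real (⋃ a ∈ A, openConn o a) - t ≤ (prodBernoulli w).real (openConn o b) := by
  by_cases hoA : o ∈ A
  · have h1t := hrel o hoA
    have hle : (prodBernoulli w).real (⋃ a ∈ A, openConn o a) ≤ 1 := measureReal_le_one
    linarith
  by_cases hbo : b = o
  · subst hbo
    have huniv : (openConn b b : Set (BondConfig (Fin n))) = Set.univ :=
      Set.eq_univ_of_forall fun _ => SimpleGraph.Reachable.refl _
    have hle : (prodBernoulli w).real (⋃ a ∈ A, openConn b a) ≤ 1 := measureReal_le_one
    rw [huniv, probReal_univ]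
    linarith
  by_cases hA : A = ∅
  · subst hA
    have h0 : (prodBernoulli w).real (⋃ a ∈ (∅ : Finset (Fin n)), openConn o a) = 0 := by simp
    have hnn : 0 ≤ (prodBernoulli w).real (openConn o b) := measureReal_nonneg
    linarith
  obtain ⟨a, haA, hmin⟩ := Finset.exists_min_image A
    (fun x => (prodBernoulli (fun e : Sym2 (Fin n) => if (∃ x ∈ e, x ∈ ({o} : Finset (Fin n)))
      then 0 else w e)).real (openConn x b)) (Finset.nonempty_iff_ne_empty.mpr hA)
  have key := hdes a haA hoA hbo hmin
  rw [agPartial_glue_singleton, Finset.set_biUnion_singleton, Finset.set_biUnion_singleton] at key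
  have hr := hrel a haA
  linarith

/-- **Additive gluing for at most two relays** (sorry-free; the σ-recursion of the line
`sigma-recursion-lemma5-any-relay` closes without its open core when `A.card ≤ 2`): on every finite weighted
graph, `P(o ↔ A) − t ≤ P(o ↔ b)` whenever `0 ≤ t`, `P(a ↔ b) ≥ 1 − t` for all `a ∈ A`, and `A.card ≤ 2`.
In print: Kozma–Nitzan arXiv:2401.12397 Thm 1 (`|A| = 2`) with `(1−x)(1−y) ≥ 1−x−y`. -/
theorem stub_agCardLeTwo :
    ∀ (n : ℕ) (w : Sym2 (Fin n) → unitInterval) (A : Finset (Fin n)) (o b : Fin n) (t : ℝ),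
      A.card ≤ 2 → 0 ≤ t →
      (∀ a ∈ A, 1 - t ≤ (prodBernoulli w).real (openConn a b)) →
      (prodBernoulli w).real (⋃ a ∈ A, openConn o a) - t ≤ (prodBernoulli w).real (openConn o b) := by
  intro n w A o b t hA2 ht hrel
  refine agPartial_final n w A o b t ht hrel ?_
  intro a haA hoA hbo hmin
  exact agPartial_designated n A hA2 _ w {o} b a rfl (Finset.disjoint_singleton_left.mpr hoA)
    (by rwa [Finset.mem_singleton]) haA hmin

/-- **Additive gluing for an observer isolated in `G ∖ A`** (any number of relays; Kozma–Nitzan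
arXiv:2401.12397 Thm 4's class, additive form, sorry-free): if every positive-weight pair at `o` (loops
excepted) goes into `A`, then `P(o ↔ A) − t ≤ P(o ↔ b)` whenever `0 ≤ t` and `P(a ↔ b) ≥ 1 − t` on `A`.
Proof: one application of the engine at the block `{o}`; every non-empty σ-layer meets `A` (KN Lemma 5),
so the defect branch is vacuous. -/
theorem stub_agIsolated :
    ∀ (n : ℕ) (w : Sym2 (Fin n) → unitInterval) (A : Finset (Fin n)) (o b : Fin n) (t : ℝ),
      (∀ y : Fin n, y ∉ A → y ≠ o → w s(o, y) = 0) → 0 ≤ t →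
      (∀ a ∈ A, 1 - t ≤ (prodBernoulli w).real (openConn a b)) →
      (prodBernoulli w).real (⋃ a ∈ A, openConn o a) - t ≤ (prodBernoulli w).real (openConn o b) := by
  intro n w A o b t hiso ht hrel
  refine agPartial_final n w A o b t ht hrel ?_
  intro a haA hoA hbo hmin
  refine stub_sigmaRecursion n w {o} A b a (Finset.disjoint_singleton_left.mpr hoA)
    (by rwa [Finset.mem_singleton]) haA (stub_sigmaGeometry n {o}) (stub_sigmaLaw n w {o}) ?_ ?_
  · intro S _ hSA hbS
    obtain ⟨v, hv⟩ := hSA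
    rw [Finset.mem_inter] at hv
    exact stub_gluingLemma5 n (fun e : Sym2 (Fin n) => if (∃ x ∈ e, x ∈ ({o} : Finset (Fin n)))
      then 0 else w e) S a v b hv.1 hbS (hmin v hv.2)
  · -- an `A`-avoiding non-empty positive layer cannot exist
    intro S hS hSne hSA _
    exfalso
    obtain ⟨x, hxS⟩ := hSne
    obtain ⟨hxo, o', ho', hw⟩ := hS x hxS
    rw [Finset.mem_singleton] at ho'
    subst ho'
    have hxA : x ∉ A := fun h => Finset.disjoint_left.1 hSA hxS h
    have hxo' : x ≠ o' := fun h => hxo (by rw [h]; exact Finset.mem_singleton_self _)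
    exact hw (hiso x hxA hxo')

/-- **Additive gluing for at most two relays** — readable alias of the registered-stub name `stub_agCardLeTwo`. -/
theorem additiveGluing_of_card_le_two :
    ∀ (n : ℕ) (w : Sym2 (Fin n) → unitInterval) (A : Finset (Fin n)) (o b : Fin n) (t : ℝ),
      A.card ≤ 2 → 0 ≤ t →
      (∀ a ∈ A, 1 - t ≤ (prodBernoulli w).real (openConn a b)) →
      (prodBernoulli w).real (⋃ a ∈ A, openConn o a) - t ≤ (prodBernoulli w).real (openConn o b) :=
  stub_agCardLeTwo

/-- **Additive gluing for an observer isolated in `G ∖ A`** — readable alias of `stub_agIsolated`. -/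
theorem additiveGluing_of_isolated :
    ∀ (n : ℕ) (w : Sym2 (Fin n) → unitInterval) (A : Finset (Fin n)) (o b : Fin n) (t : ℝ),
      (∀ y : Fin n, y ∉ A → y ≠ o → w s(o, y) = 0) → 0 ≤ t →
      (∀ a ∈ A, 1 - t ≤ (prodBernoulli w).real (openConn a b)) →
      (prodBernoulli w).real (⋃ a ∈ A, openConn o a) - t ≤ (prodBernoulli w).real (openConn o b) :=
  stub_agIsolated

end

end Summit.CriticalPhenomena.PercolationContinuityZ3.Theorems
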